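import Summits.AtomisticToContinuum.HydrodynamicLimit.Theses.AntiMazurCoboundaries
import Literature.MathematicalPhysics.KineticTheory.HardSphereEulerProofs
import Literature.MathematicalPhysics.KineticTheory.HardBallErgodicity

/-!
# Stub `stub_correctorMinimax` of line `almost-invariant-duality` — crux `AntiMazurCoboundaries.CorrectorPressureDecay`
(stmt-AtomisticToContinuum-14135)

Helper file (`--supports stmt-AtomisticToContinuum-14135`) proving the registered stub
`stub_correctorMinimax` of the lead's skeleton
`Cruxes/CorrectorPressureDecay/Lines/almost-invariant-duality.lean`: the `ε`-slack finite-volume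
minimax on an abstract probability space `(X, μ)` with a measure-preserving `T`, a bounded
measurable `F` and the cost ball `𝒲 = {W measurable, |W| ≤ M, ∫⁻ exp (c |W|) ≤ K}`.

Proof summary (finite descent, no compactness).  Write `2 G_W := 2 (F - lag⁻¹ (W ∘ T - W))` for
the *tilt* of `W` and `Z(W) := ∫ exp (2 G_W) dμ`.  Over the box `|W| ≤ M` the tilt is bounded by
a constant `S` (`abs_tilt_le`), so `log Z(W) ∈ [-S, S]` (`partition_bounds`).  Testing the
hypothesis against the Gibbs density `exp (2 G_W) / Z(W)` and using the Gibbs identity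
`∫ ρ log ρ = ∫ 2 G_W ρ - log Z(W)` gives a competitor `W' ∈ 𝒲` with first variation
`∫ (2 G_{W'} - 2 G_W) exp (2 G_W) ≤ (B - log Z(W)) Z(W)` (`dual_step`).  The cost ball is convex
(`costBall_convex`), the tilt is affine in `W`, and `exp u ≤ 1 + u + u²` for `|u| ≤ 1` bounds `Z`
along the segment towards `W'` to second order (`second_order`); hence while `log Z(W) > B + ε`
the fixed step `t = min (1/(2S)) (ε/(2(2S)²))` lowers `log Z` by `t ε / 2` inside `𝒲`
(`descent_step`).  Iterating from the point supplied by the hypothesis at `ρ ≡ 1`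
(`descent_iter`) for more than `4 S / (t ε)` steps forces `log Z ≤ B + ε`, i.e. the claim.
-/

noncomputable section

open MeasureTheory ProbabilityTheory Set Filter Topology
open scoped ENNReal

namespace Summit.AtomisticToContinuum.HydrodynamicLimit.Theorems.AlmostInvariantDuality

open Literature.MathematicalPhysics.KineticTheory (T3 V3 hsDiameter localGibbsLaw)
open Literature.Analysis.FluidPDE (HardSphereFlow Config configMomentum configEnergy)

/-- Uniform bound on the tilt `2 (F - lag⁻¹ (W ∘ T - W))` over the box `|W| ≤ M`. -/
private theorem abs_tilt_le {X : Type} {T : X → X} {F W : X → ℝ} {lag M CF : ℝ} (hlag : 0 < lag)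
    (hCF : ∀ x, |F x| ≤ CF) (hW : ∀ x, |W x| ≤ M) (x : X) :
    |2 * (F x - lag⁻¹ * (W (T x) - W x))| ≤ 2 * (|CF| + lag⁻¹ * (2 * M)) + 1 := by
  have hli : 0 < lag⁻¹ := inv_pos.2 hlag
  have h4 : |W (T x) - W x| ≤ 2 * M := (abs_sub _ _).trans (by linarith [hW (T x), hW x])
  have h5 : |lag⁻¹ * (W (T x) - W x)| ≤ lag⁻¹ * (2 * M) := by
    rw [abs_mul, abs_of_pos hli]
    exact mul_le_mul_of_nonneg_left h4 hli.le
  rw [abs_mul, abs_two]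
  linarith [abs_sub (F x) (lag⁻¹ * (W (T x) - W x)), hCF x, le_abs_self CF]

section Abstract

variable {X : Type} [MeasurableSpace X] {μ : Measure X}

/-- A measurable real function with a uniform bound on its absolute value is integrable against a
finite measure. -/
private theorem integrable_of_abs_le [IsFiniteMeasure μ] {g : X → ℝ} (hg : Measurable g) (C : ℝ)
    (hC : ∀ x, |g x| ≤ C) : Integrable g μ :=
  Integrable.of_bound hg.aestronglyMeasurable C (ae_of_all _ fun x => by
    rw [Real.norm_eq_abs]; exact hC x)

/-- The product of two measurable real functions with bounded absolute values is integrable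
against a finite measure. -/
private theorem integrable_mul_of_abs_le [IsFiniteMeasure μ] {g h : X → ℝ} (hg : Measurable g)
    (hh : Measurable h) {C D : ℝ} (hC : ∀ x, |g x| ≤ C) (hD : ∀ x, |h x| ≤ D) :
    Integrable (fun x => g x * h x) μ :=
  integrable_of_abs_le (hg.mul hh) (C * D) fun x => by
    rw [abs_mul]
    exact mul_le_mul (hC x) (hD x) (abs_nonneg _) ((abs_nonneg _).trans (hC x))

/-- Partition-function bounds: for measurable `p` with `|p| ≤ S` on a probability space, `exp p`
is integrable, `|exp p| ≤ exp S`, and `exp (-S) ≤ ∫ exp p ≤ exp S`. -/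
private theorem partition_bounds [IsProbabilityMeasure μ] {p : X → ℝ} (hp : Measurable p)
    {S : ℝ} (hpS : ∀ x, |p x| ≤ S) :
    Integrable (fun x => Real.exp (p x)) μ ∧ (∀ x, |Real.exp (p x)| ≤ Real.exp S) ∧
      Real.exp (-S) ≤ ∫ x, Real.exp (p x) ∂μ ∧ ∫ x, Real.exp (p x) ∂μ ≤ Real.exp S := by
  have hlo : ∀ x, Real.exp (-S) ≤ Real.exp (p x) := fun x =>
    Real.exp_le_exp.2 (abs_le.1 (hpS x)).1
  have hhi : ∀ x, Real.exp (p x) ≤ Real.exp S := fun x => Real.exp_le_exp.2 (abs_le.1 (hpS x)).2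
  have habs : ∀ x, |Real.exp (p x)| ≤ Real.exp S := fun x => by rw [Real.abs_exp]; exact hhi x
  have hm : Measurable fun x => Real.exp (p x) := by fun_prop
  have hi : Integrable (fun x => Real.exp (p x)) μ := integrable_of_abs_le hm _ habs
  refine ⟨hi, habs, ?_, ?_⟩
  · simpa using integral_mono (integrable_const (Real.exp (-S))) hi hlo
  · simpa using integral_mono hi (integrable_const (Real.exp S)) hhi

/-- The cost ball `{W measurable, |W| ≤ M, ∫⁻ exp (c |W|) ≤ K}` is convex: it contains the point
`W + t (W' - W)`, `t ∈ [0, 1]`, of the segment between any two of its members. -/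
private theorem costBall_convex {W W' : X → ℝ} (hW : Measurable W) (hW' : Measurable W')
    {M c : ℝ} (hc : 0 ≤ c) {K : ℝ≥0∞} (hWM : ∀ x, |W x| ≤ M) (hW'M : ∀ x, |W' x| ≤ M)
    (hWK : ∫⁻ x, ENNReal.ofReal (Real.exp (c * |W x|)) ∂μ ≤ K)
    (hW'K : ∫⁻ x, ENNReal.ofReal (Real.exp (c * |W' x|)) ∂μ ≤ K) {t : ℝ} (ht0 : 0 ≤ t)
    (ht1 : t ≤ 1) :
    Measurable (fun x => W x + t * (W' x - W x)) ∧ (∀ x, |W x + t * (W' x - W x)| ≤ M) ∧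
      ∫⁻ x, ENNReal.ofReal (Real.exp (c * |W x + t * (W' x - W x)|)) ∂μ ≤ K := by
  have ht1' : 0 ≤ 1 - t := sub_nonneg.2 ht1
  have habs : ∀ x, |W x + t * (W' x - W x)| ≤ (1 - t) * |W x| + t * |W' x| := fun x => by
    rw [show W x + t * (W' x - W x) = (1 - t) * W x + t * W' x by ring]
    refine (abs_add_le _ _).trans_eq ?_
    rw [abs_mul, abs_mul, abs_of_nonneg ht0, abs_of_nonneg ht1']
  refine ⟨by fun_prop, fun x => (habs x).trans (by nlinarith [hWM x, hW'M x]), ?_⟩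
  -- pointwise convexity of `u ↦ exp (c |u|)`
  have hpt : ∀ x, ENNReal.ofReal (Real.exp (c * |W x + t * (W' x - W x)|)) ≤
      ENNReal.ofReal (1 - t) * ENNReal.ofReal (Real.exp (c * |W x|)) +
        ENNReal.ofReal t * ENNReal.ofReal (Real.exp (c * |W' x|)) := fun x => by
    rw [← ENNReal.ofReal_mul ht1', ← ENNReal.ofReal_mul ht0, ← ENNReal.ofReal_add
      (mul_nonneg ht1' (Real.exp_pos _).le) (mul_nonneg ht0 (Real.exp_pos _).le)]
    have hconv := convexOn_exp.2 (Set.mem_univ (c * |W x|)) (Set.mem_univ (c * |W' x|))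
      ht1' ht0 (by ring)
    simp only [smul_eq_mul] at hconv
    refine ENNReal.ofReal_le_ofReal ((Real.exp_le_exp.2 ?_).trans hconv)
    calc c * |W x + t * (W' x - W x)| ≤ c * ((1 - t) * |W x| + t * |W' x|) :=
          mul_le_mul_of_nonneg_left (habs x) hc
      _ = (1 - t) * (c * |W x|) + t * (c * |W' x|) := by ring
  refine (lintegral_mono hpt).trans ?_
  rw [lintegral_add_left (by fun_prop), lintegral_const_mul _ (by fun_prop),
    lintegral_const_mul _ (by fun_prop)]
  refine (add_le_add (mul_le_mul_right hWK _) (mul_le_mul_right hW'K _)).trans_eq ?_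
  rw [← add_mul, ← ENNReal.ofReal_add ht1' ht0, sub_add_cancel, ENNReal.ofReal_one, one_mul]

/-- Second-order expansion of the partition function along a segment: for `|p|, |q| ≤ S` and
`0 ≤ t` with `t (2 S) ≤ 1`, the integral `∫ exp (p + t (q - p))` is positive and at most
`∫ exp p + t ∫ (q - p) exp p + t² (2S)² ∫ exp p` (from `exp u ≤ 1 + u + u²` for `|u| ≤ 1`). -/
private theorem second_order [IsProbabilityMeasure μ] {p q : X → ℝ} (hp : Measurable p)
    (hq : Measurable q) {S : ℝ} (hpS : ∀ x, |p x| ≤ S) (hqS : ∀ x, |q x| ≤ S) {t : ℝ}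
    (ht0 : 0 ≤ t) (ht : t * (2 * S) ≤ 1) :
    0 < ∫ x, Real.exp (p x + t * (q x - p x)) ∂μ ∧
      ∫ x, Real.exp (p x + t * (q x - p x)) ∂μ ≤
        ∫ x, Real.exp (p x) ∂μ + t * ∫ x, (q x - p x) * Real.exp (p x) ∂μ +
          t ^ 2 * (2 * S) ^ 2 * ∫ x, Real.exp (p x) ∂μ := by
  obtain ⟨hexp_int, hexpS, -, -⟩ := partition_bounds (μ := μ) hp hpS
  have hd : ∀ x, |q x - p x| ≤ 2 * S := fun x =>
    (abs_sub _ _).trans (by linarith [hqS x, hpS x])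
  have hde_int : Integrable (fun x => (q x - p x) * Real.exp (p x)) μ :=
    integrable_mul_of_abs_le (hq.sub hp) hp.exp hd hexpS
  have hu : ∀ x, |t * (q x - p x)| ≤ 1 := fun x => by
    rw [abs_mul, abs_of_nonneg ht0]
    exact (mul_le_mul_of_nonneg_left (hd x) ht0).trans ht
  -- the exponent on the left is bounded by `S + 1`
  obtain ⟨hlhs_int, -, hlo, -⟩ := partition_bounds (μ := μ) (S := S + 1)
    (by fun_prop : Measurable fun x => p x + t * (q x - p x)) fun x =>
      (abs_add_le _ _).trans (add_le_add (hpS x) (hu x))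
  refine ⟨lt_of_lt_of_le (Real.exp_pos _) hlo, ?_⟩
  -- pointwise second-order bound
  have hpt : ∀ x, Real.exp (p x + t * (q x - p x)) ≤
      Real.exp (p x) + t * ((q x - p x) * Real.exp (p x)) +
        t ^ 2 * (2 * S) ^ 2 * Real.exp (p x) := fun x => by
    have h1 := (abs_le.1 (Real.abs_exp_sub_one_sub_id_le (hu x))).2
    have h2 : (t * (q x - p x)) ^ 2 ≤ t ^ 2 * (2 * S) ^ 2 := by
      rw [mul_pow]
      exact mul_le_mul_of_nonneg_left (sq_le_sq' (abs_le.1 (hd x)).1 (abs_le.1 (hd x)).2)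
        (sq_nonneg t)
    rw [Real.exp_add]
    calc Real.exp (p x) * Real.exp (t * (q x - p x))
        ≤ Real.exp (p x) * (1 + t * (q x - p x) + t ^ 2 * (2 * S) ^ 2) :=
          mul_le_mul_of_nonneg_left (by linarith) (Real.exp_pos _).le
      _ = _ := by ring
  -- integrate
  have i3 : Integrable (fun x => t * ((q x - p x) * Real.exp (p x))) μ := hde_int.const_mul t
  have i1 : Integrable (fun x => Real.exp (p x) + t * ((q x - p x) * Real.exp (p x))) μ :=
    hexp_int.add i3
  have i2 : Integrable (fun x => t ^ 2 * (2 * S) ^ 2 * Real.exp (p x)) μ := hexp_int.const_mul _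
  have i12 : Integrable (fun x => Real.exp (p x) + t * ((q x - p x) * Real.exp (p x)) +
      t ^ 2 * (2 * S) ^ 2 * Real.exp (p x)) μ := i1.add i2
  refine (integral_mono hlhs_int i12 hpt).trans_eq ?_
  rw [integral_add i1 i2, integral_add hexp_int i3, integral_const_mul, integral_const_mul]

section Descent

variable [IsProbabilityMeasure μ] {T : X → X} (hT : Measurable T) {F : X → ℝ} (hF : Measurable F)
  {lag M B c S : ℝ} {K : ℝ≥0∞}
  (hS : ∀ W : X → ℝ, (∀ x, |W x| ≤ M) → ∀ x, |2 * (F x - lag⁻¹ * (W (T x) - W x))| ≤ S)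
  (hyp : ∀ ρ : X → ℝ, Measurable ρ → (∀ x, 0 ≤ ρ x) → (∃ C : ℝ, ∀ x, ρ x ≤ C) →
    ∫ x, ρ x ∂μ = 1 →
      ∃ W : X → ℝ, Measurable W ∧ (∀ x, |W x| ≤ M) ∧
        ∫⁻ x, ENNReal.ofReal (Real.exp (c * |W x|)) ∂μ ≤ K ∧
        2 * ∫ x, (F x - lag⁻¹ * (W (T x) - W x)) * ρ x ∂μ - ∫ x, ρ x * Real.log (ρ x) ∂μ ≤ B)
include hT hF hS hyp

/-- Gibbs step.  Testing the dual hypothesis against the Gibbs density `exp p / Z`, `Z = ∫ exp p`,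
and using the Gibbs identity `∫ ρ log ρ = ∫ p ρ - log Z` yields a competitor `W` in the cost
ball whose first variation `∫ (2 G_W - p) exp p` is at most `(B - log Z) Z`. -/
private theorem dual_step {p : X → ℝ} (hp : Measurable p) (hpS : ∀ x, |p x| ≤ S) :
    ∃ W : X → ℝ, Measurable W ∧ (∀ x, |W x| ≤ M) ∧
      ∫⁻ x, ENNReal.ofReal (Real.exp (c * |W x|)) ∂μ ≤ K ∧
      ∫ x, (2 * (F x - lag⁻¹ * (W (T x) - W x)) - p x) * Real.exp (p x) ∂μ ≤
        (B - Real.log (∫ x, Real.exp (p x) ∂μ)) * ∫ x, Real.exp (p x) ∂μ := by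
  obtain ⟨hexp_int, hexpS, -, -⟩ := partition_bounds (μ := μ) hp hpS
  set Z : ℝ := ∫ x, Real.exp (p x) ∂μ with hZ
  have hZpos : 0 < Z := integral_exp_pos hexp_int
  have hZne : Z ≠ 0 := hZpos.ne'
  -- the Gibbs density `exp p / Z` is an admissible test density
  have hρ_bd : ∃ C : ℝ, ∀ x, Real.exp (p x) / Z ≤ C := ⟨Real.exp S / Z, fun x =>
    div_le_div_of_nonneg_right ((le_abs_self _).trans (hexpS x)) hZpos.le⟩
  have hρ_one : ∫ x, Real.exp (p x) / Z ∂μ = 1 := by rw [integral_div, ← hZ, div_self hZne]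
  obtain ⟨W, hWm, hWM, hWK, hWB⟩ := hyp (fun x => Real.exp (p x) / Z) (hp.exp.div_const Z)
    (fun x => div_nonneg (Real.exp_pos _).le hZpos.le) hρ_bd hρ_one
  refine ⟨W, hWm, hWM, hWK, ?_⟩
  have hWB' : 2 * ∫ x, (F x - lag⁻¹ * (W (T x) - W x)) * (Real.exp (p x) / Z) ∂μ -
      ∫ x, Real.exp (p x) / Z * Real.log (Real.exp (p x) / Z) ∂μ ≤ B := hWB
  have hqe_int :
      Integrable (fun x => 2 * (F x - lag⁻¹ * (W (T x) - W x)) * Real.exp (p x)) μ :=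
    integrable_mul_of_abs_le (by fun_prop) hp.exp (hS W hWM) hexpS
  have hpe_int : Integrable (fun x => p x * Real.exp (p x)) μ :=
    integrable_mul_of_abs_le hp hp.exp hpS hexpS
  -- Gibbs identity for the entropy of the Gibbs density
  have hent : ∫ x, Real.exp (p x) / Z * Real.log (Real.exp (p x) / Z) ∂μ =
      Z⁻¹ * ∫ x, p x * Real.exp (p x) ∂μ - Real.log Z := by
    have h1 : (fun x => Real.exp (p x) / Z * Real.log (Real.exp (p x) / Z)) =
        fun x => Z⁻¹ * (p x * Real.exp (p x)) - Real.log Z * Z⁻¹ * Real.exp (p x) := by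
      funext x
      rw [Real.log_div (Real.exp_pos _).ne' hZne, Real.log_exp]
      ring
    have i1 : Integrable (fun x => Z⁻¹ * (p x * Real.exp (p x))) μ := hpe_int.const_mul _
    have i2 : Integrable (fun x => Real.log Z * Z⁻¹ * Real.exp (p x)) μ := hexp_int.const_mul _
    rw [h1, integral_sub i1 i2, integral_const_mul, integral_const_mul, ← hZ, mul_assoc,
      inv_mul_cancel₀ hZne, mul_one]
  -- the linear term and the first variation
  have hlin : 2 * ∫ x, (F x - lag⁻¹ * (W (T x) - W x)) * (Real.exp (p x) / Z) ∂μ =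
      Z⁻¹ * ∫ x, 2 * (F x - lag⁻¹ * (W (T x) - W x)) * Real.exp (p x) ∂μ := by
    rw [← integral_const_mul, ← integral_const_mul]
    congr 1
    funext x
    ring
  have hsub : ∫ x, (2 * (F x - lag⁻¹ * (W (T x) - W x)) - p x) * Real.exp (p x) ∂μ =
      ∫ x, 2 * (F x - lag⁻¹ * (W (T x) - W x)) * Real.exp (p x) ∂μ -
        ∫ x, p x * Real.exp (p x) ∂μ := by
    rw [← integral_sub hqe_int hpe_int]
    congr 1
    funext x
    ring
  rw [hent, hlin] at hWB'
  rw [hsub, ← div_le_iff₀ hZpos, sub_div, div_eq_inv_mul, div_eq_inv_mul]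
  linarith

variable {ε t : ℝ} (hc : 0 ≤ c) (ht0 : 0 < t) (ht1 : t ≤ 1) (htS : t * (2 * S) ≤ 1)
  (htε : t * (2 * S) ^ 2 ≤ ε / 2)
include hc ht0 ht1 htS htε

/-- One descent step.  If `W` lies in the cost ball and its pressure `log ∫ exp (2 G_W)` exceeds
`B + ε`, then moving the fixed step `t` towards the competitor produced by `dual_step` stays in
the cost ball and lowers the pressure by at least `t ε / 2`. -/
private theorem descent_step {W : X → ℝ} (hWm : Measurable W) (hWM : ∀ x, |W x| ≤ M)
    (hWK : ∫⁻ x, ENNReal.ofReal (Real.exp (c * |W x|)) ∂μ ≤ K)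
    (hgap : B + ε < Real.log (∫ x, Real.exp (2 * (F x - lag⁻¹ * (W (T x) - W x))) ∂μ)) :
    ∃ W' : X → ℝ, Measurable W' ∧ (∀ x, |W' x| ≤ M) ∧
      ∫⁻ x, ENNReal.ofReal (Real.exp (c * |W' x|)) ∂μ ≤ K ∧
      Real.log (∫ x, Real.exp (2 * (F x - lag⁻¹ * (W' (T x) - W' x))) ∂μ) ≤
        Real.log (∫ x, Real.exp (2 * (F x - lag⁻¹ * (W (T x) - W x))) ∂μ) - t * ε / 2 := by
  -- the tilt `p` of `W` and its partition function `Z`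
  set p : X → ℝ := fun x => 2 * (F x - lag⁻¹ * (W (T x) - W x)) with hp_def
  have hp : Measurable p := by simp only [hp_def]; fun_prop
  have hpS : ∀ x, |p x| ≤ S := hS W hWM
  obtain ⟨hexp_int, -, -, -⟩ := partition_bounds (μ := μ) hp hpS
  set Z : ℝ := ∫ x, Real.exp (p x) ∂μ with hZ_def
  have hZpos : 0 < Z := integral_exp_pos hexp_int
  have hgap' : B + ε < Real.log Z := hgap
  -- Gibbs step: a competitor `W'`, with tilt `q`, whose first variation is below `-ε Z`
  obtain ⟨W', hW'm, hW'M, hW'K, hvar⟩ := dual_step hT hF hS hyp hp hpS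
  set q : X → ℝ := fun x => 2 * (F x - lag⁻¹ * (W' (T x) - W' x)) with hq_def
  have hq : Measurable q := by simp only [hq_def]; fun_prop
  have hvar' : ∫ x, (q x - p x) * Real.exp (p x) ∂μ ≤ (B - Real.log Z) * Z := hvar
  have hA : ∫ x, (q x - p x) * Real.exp (p x) ∂μ ≤ -ε * Z :=
    hvar'.trans (mul_le_mul_of_nonneg_right (by linarith) hZpos.le)
  -- second-order bound along the segment towards `W'`: `Z_t ≤ Z (1 - t ε / 2)`
  obtain ⟨hZtpos, hso⟩ : 0 < ∫ x, Real.exp (p x + t * (q x - p x)) ∂μ ∧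
      ∫ x, Real.exp (p x + t * (q x - p x)) ∂μ ≤
        Z + t * ∫ x, (q x - p x) * Real.exp (p x) ∂μ + t ^ 2 * (2 * S) ^ 2 * Z :=
    second_order hp hq hpS (hS W' hW'M) ht0.le htS
  have hZt : ∫ x, Real.exp (p x + t * (q x - p x)) ∂μ ≤ Z * (1 - t * ε / 2) := by
    have h1 : t * ∫ x, (q x - p x) * Real.exp (p x) ∂μ ≤ t * (-ε * Z) :=
      mul_le_mul_of_nonneg_left hA ht0.le
    have h2 : t * (t * (2 * S) ^ 2) * Z ≤ t * (ε / 2) * Z :=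
      mul_le_mul_of_nonneg_right (mul_le_mul_of_nonneg_left htε ht0.le) hZpos.le
    linarith
  -- the new point `W + t (W' - W)` of the cost ball has tilt `p + t (q - p)`
  obtain ⟨hWtm, hWtM, hWtK⟩ := costBall_convex hWm hW'm hc hWM hW'M hWK hW'K ht0.le ht1
  refine ⟨fun x => W x + t * (W' x - W x), hWtm, hWtM, hWtK, ?_⟩
  have hZt_eq : ∫ x, Real.exp (2 * (F x - lag⁻¹ *
      ((W (T x) + t * (W' (T x) - W (T x))) - (W x + t * (W' x - W x))))) ∂μ =
      ∫ x, Real.exp (p x + t * (q x - p x)) ∂μ := by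
    congr 1
    funext x
    congr 1
    simp only [hp_def, hq_def]
    ring
  show Real.log (∫ x, Real.exp (2 * (F x - lag⁻¹ *
      ((W (T x) + t * (W' (T x) - W (T x))) - (W x + t * (W' x - W x))))) ∂μ) ≤
    Real.log Z - t * ε / 2
  rw [hZt_eq]
  have hratio : (∫ x, Real.exp (p x + t * (q x - p x)) ∂μ) / Z ≤ 1 - t * ε / 2 := by
    rw [div_le_iff₀ hZpos]
    linarith
  have hlog := Real.log_le_sub_one_of_pos (div_pos hZtpos hZpos)
  rw [Real.log_div hZtpos.ne' hZpos.ne'] at hlog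
  linarith

/-- Iterated descent: after `k` steps of `descent_step`, started from the point supplied by the
hypothesis at `ρ ≡ 1`, there is a point of the cost ball whose pressure is either already at most
`B + ε` or at most `S - k (t ε / 2)`. -/
private theorem descent_iter (k : ℕ) :
    ∃ W : X → ℝ, Measurable W ∧ (∀ x, |W x| ≤ M) ∧
      ∫⁻ x, ENNReal.ofReal (Real.exp (c * |W x|)) ∂μ ≤ K ∧
      (Real.log (∫ x, Real.exp (2 * (F x - lag⁻¹ * (W (T x) - W x))) ∂μ) ≤ B + ε ∨
        Real.log (∫ x, Real.exp (2 * (F x - lag⁻¹ * (W (T x) - W x))) ∂μ) ≤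
          S - k * (t * ε / 2)) := by
  induction k with
  | zero =>
    obtain ⟨W, hWm, hWM, hWK, -⟩ := hyp (fun _ => 1) measurable_const (fun _ => zero_le_one)
      ⟨1, fun _ => le_rfl⟩ (by simp)
    refine ⟨W, hWm, hWM, hWK, Or.inr ?_⟩
    have hp : Measurable fun x => 2 * (F x - lag⁻¹ * (W (T x) - W x)) := by fun_prop
    obtain ⟨hint, -, -, hhi⟩ := partition_bounds (μ := μ) hp (hS W hWM)
    rw [Nat.cast_zero, zero_mul, sub_zero, Real.log_le_iff_le_exp (integral_exp_pos hint)]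
    exact hhi
  | succ k ih =>
    obtain ⟨W, hWm, hWM, hWK, hW⟩ := ih
    by_cases hle : Real.log (∫ x, Real.exp (2 * (F x - lag⁻¹ * (W (T x) - W x))) ∂μ) ≤ B + ε
    · exact ⟨W, hWm, hWM, hWK, Or.inl hle⟩
    obtain ⟨W', hW'm, hW'M, hW'K, hdrop⟩ :=
      descent_step hT hF hS hyp hc ht0 ht1 htS htε hWm hWM hWK (not_le.1 hle)
    refine ⟨W', hW'm, hW'M, hW'K, Or.inr ?_⟩
    have h := hW.resolve_left hle
    push_cast
    linarith

end Descent

end Abstract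

/-- STUB 1 (size M; TRUE — ε-slack minimax by finite descent + Gibbs identity, see `CorrectorMinimaxEps`).
Sources: Sion1958 doi:10.2140/pjm.1958.8.171 (what it replaces); KipnisLandim1999 App. 1 §8 (entropy variational formula). -/
theorem stub_correctorMinimax :
    ∀ (X : Type) [MeasurableSpace X] (μ : Measure X) [IsProbabilityMeasure μ] (T : X → X),
      MeasurePreserving T μ μ →
      ∀ F : X → ℝ, Measurable F → (∃ C : ℝ, ∀ x, |F x| ≤ C) →
      ∀ (lag c M B : ℝ) (K : ℝ≥0∞), 0 < lag → 0 < c → 0 ≤ M →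
      (∀ ρ : X → ℝ, Measurable ρ → (∀ x, 0 ≤ ρ x) → (∃ C : ℝ, ∀ x, ρ x ≤ C) → ∫ x, ρ x ∂μ = 1 →
        ∃ W : X → ℝ, Measurable W ∧ (∀ x, |W x| ≤ M) ∧
          ∫⁻ x, ENNReal.ofReal (Real.exp (c * |W x|)) ∂μ ≤ K ∧
          2 * ∫ x, (F x - lag⁻¹ * (W (T x) - W x)) * ρ x ∂μ - ∫ x, ρ x * Real.log (ρ x) ∂μ ≤ B) →
      ∀ ε : ℝ, 0 < ε →
      ∃ W : X → ℝ, Measurable W ∧ (∀ x, |W x| ≤ M) ∧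
        ∫⁻ x, ENNReal.ofReal (Real.exp (c * |W x|)) ∂μ ≤ K ∧
        ∫⁻ x, ENNReal.ofReal (Real.exp (2 * (F x - lag⁻¹ * (W (T x) - W x)))) ∂μ ≤
          ENNReal.ofReal (Real.exp (B + ε)) := by
  intro X _ μ _ T hT F hF hFb lag c M B K hlag hc hM hyp ε hε
  have hTm : Measurable T := hT.measurable
  obtain ⟨CF, hCF⟩ := hFb
  -- uniform bound `S ≥ 1` on the tilt over the box `|W| ≤ M`
  set S : ℝ := 2 * (|CF| + lag⁻¹ * (2 * M)) + 1 with hS_def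
  have hS : ∀ W : X → ℝ, (∀ x, |W x| ≤ M) → ∀ x, |2 * (F x - lag⁻¹ * (W (T x) - W x))| ≤ S :=
    fun W hW x => abs_tilt_le hlag hCF hW x
  have hS1 : 1 ≤ S := by
    have h1 : 0 ≤ lag⁻¹ * (2 * M) := by positivity
    linarith [abs_nonneg CF]
  have hSpos : 0 < S := by linarith
  -- the step size `t` and the number of steps `k`
  set t : ℝ := min (1 / (2 * S)) (ε / (2 * (2 * S) ^ 2)) with ht_def
  have ht0 : 0 < t := lt_min (by positivity) (by positivity)
  have htS : t * (2 * S) ≤ 1 :=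
    (mul_le_mul_of_nonneg_right (min_le_left _ _) (by positivity)).trans_eq
      (one_div_mul_cancel (by positivity))
  have ht1 : t ≤ 1 := by nlinarith
  have htε : t * (2 * S) ^ 2 ≤ ε / 2 := by
    refine (mul_le_mul_of_nonneg_right (min_le_right _ _) (by positivity)).trans_eq ?_
    rw [div_mul_eq_mul_div, mul_div_mul_right _ _ (by positivity)]
  obtain ⟨k, hk⟩ := exists_nat_gt (2 * S / (t * ε / 2))
  rw [div_lt_iff₀ (by positivity)] at hk
  -- finite descent, then `log Z ≤ B + ε` by the lower partition-function bound
  obtain ⟨W, hWm, hWM, hWK, hW⟩ := descent_iter hTm hF hS hyp hc.le ht0 ht1 htS htε k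
  refine ⟨W, hWm, hWM, hWK, ?_⟩
  have hp : Measurable fun x => 2 * (F x - lag⁻¹ * (W (T x) - W x)) := by fun_prop
  obtain ⟨hint, -, hZlo, -⟩ := partition_bounds (μ := μ) hp (hS W hWM)
  have hZpos := integral_exp_pos hint
  have hlogZ : Real.log (∫ x, Real.exp (2 * (F x - lag⁻¹ * (W (T x) - W x))) ∂μ) ≤ B + ε := by
    refine hW.resolve_right fun h => ?_
    have hlo := (Real.le_log_iff_exp_le hZpos).2 hZlo
    linarith
  rw [← ofReal_integral_eq_lintegral_ofReal hint (ae_of_all _ fun x => (Real.exp_pos _).le)]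
  exact ENNReal.ofReal_le_ofReal ((Real.log_le_iff_le_exp hZpos).1 hlogZ)

end Summit.AtomisticToContinuum.HydrodynamicLimit.Theorems.AlmostInvariantDuality

end
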